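import Literature.AlgebraicGeometry.Frobenioids.PadicFrobenioidLogpDivisorTransport
import HarnessLib

/-!
# Frobenioids II, Ex. 1.1 / Frobenioids I, Cor. 4.11 (iv): a self-equivalence of a `p`-adic Frobenioid lying over the
# IDENTITY of its base induces the identity on the divisor monoid

Mochizuki, *The geometry of Frobenioids I*, Kyushu J. Math. **62** (2008), Corollary 4.11 (iv) p. 92 (`Ψ^Base`, `Ψ^Φ`,
`Div(Ψ φ) = η^* Ψ^Φ(Div φ)`) [cite: MochizukiFrdI2008, Cor. 4.11 (iv) p.92]; *The geometry of Frobenioids II*, Kyushu J.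
Math. **62** (2008), Example 1.1 (ii) p. 8 (the `p`-adic Frobenioid, `Φ ⊆ ord(𝒪^▷) ⊗ ℝ_{≥0}` monoprime), Theorem 1.2 (i)
p. 9 [cite: MochizukiFrdII2008, Ex 1.1 (ii) p.8]; consumer locus [IUTchI] Cor. 5.3 (ii)/(iv) p. 144 l. 45 ("we suppose
[without loss of generality] that `α` lies over the identity self-equivalence of `𝒟_v`") and p. 145 l. 1–2 ("`α` induces
… the identity on the … divisor monoids") [cite: Mochizuki2012, Cor. 5.3(iv) p.145].

PROOF-ONLY (abc-iut, row «C53ii/S2c HMON-AT-REAL-CV», brick 1 = `hdiv@C_v`; this file abc-iut-L1-t7; template and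
inputs BY NAME: abc-iut-L1-t4's `PadicFrobenioidLogpDivisorTransport.lean`, abc-iut-w4-d109's
`PadicFrd.exists_cor411iv_data_padic`).  THE THEOREM (`div_map_eq_pull_of_over_base`): for a `p`-adic Frobenioid
`C = d.frobenioid` over a SLIM base of FSM-type whose divisor monoid contains the integral classes (INT) and is contained
in their perfection (PF: every class has an integral power — e.g. `Φ = ord(𝒪^▷)` or `ord(𝒪^▷)^pf`), every
self-equivalence `Ψ : C ≌ C` equipped with `η₀ : Ψ ⋙ Base ≅ Base` satisfies `Div(Ψ φ) = η₀^* Div(φ)` for ALL morphisms —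
the hypothesis `hdiv` of the rigidity theorems `ModelFrobenioid.selfEquivalence_iso_id_of_over_base_of_ratio/_of_endUnits`.
PROOF: by Cor. 4.11 (iv) `Div(Ψ φ) = η^* Ψ^Φ(Div φ)`; the automorphism `S := η₀,* ∘ η^* ∘ Ψ^Φ` of `Φ(A)` maps integral
classes bijectively to integral classes (linear endomorphisms, Frobenius degrees, fullness of `Ψ` — §1 of the template;
pull-backs preserve integrality by naturality of `ι : Φ ↪ Φ₀`), so induces an automorphism of `ord(𝒪^▷_{K_A}) ≅ ℤ_{≥0}`,
which is the identity (`mulEquiv_eq_of_isZMonoprime`); by (PF) and uniqueness of roots in `Φ₀ = ord ⊗ ℝ_{≥0}`, `S = id`.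
No statement of either paper is restated as a fact; nothing here bears on [IUTchIII] Cor. 3.12.
-/

namespace Literature.AlgebraicGeometry.Frobenioids

open CategoryTheory Opposite Function
open scoped NNReal

universe v u

/-- In `M ⊗ ℝ_{≥0} = Hom(Hom(M, ℝ_{≥0}), ℝ_{≥0})` `n`-th roots are unique (`n ≥ 1`). [cite: MochizukiFrdI2008, §0 p.10] -/
theorem Realification.pow_left_injective {M : Type u} [CommMonoid M] {n : ℕ} (hn : 0 < n)
    {F G : Realification M} (h : F ^ n = G ^ n) : F = G := by
  change (show RDual (RDual M) from F) = (show RDual (RDual M) from G)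
  have h' : (show RDual (RDual M) from F) ^ n = (show RDual (RDual M) from G) ^ n := h
  refine MonoidHom.ext fun g => ?_
  have h1 := DFunLike.congr_fun h' g
  rw [MonoidHom.pow_apply, MonoidHom.pow_apply] at h1
  have h2 : n • Multiplicative.toAdd ((show RDual (RDual M) from F) g) =
      n • Multiplicative.toAdd ((show RDual (RDual M) from G) g) := by
    rw [← toAdd_pow, ← toAdd_pow, h1]
  exact Multiplicative.toAdd.injective (smul_right_injective NNReal hn.ne' h2)

namespace PadicFrd

namespace Datum

variable {D : Type u} [Category.{v} D] {p : ℕ} [Fact p.Prime] (d : Datum D p)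

/-- **Pull-backs preserve integral classes**: if `ι c = a ⊗ 1` with `a ∈ ord(O^⊳_{K_A})`, then for every base arrow
`b : A' → A`, `ι(b^* c) = a' ⊗ 1` with `a'` the image of `a` under the induced map of value monoids (naturality of
`ι : Φ ↪ Φ₀` and `Φ₀(b) = (ord map) ⊗ ℝ_{≥0}`). [cite: MochizukiFrdII2008, Ex 1.1 (ii) p.8] -/
theorem exists_ιHom_pull_eq_of {A A' : D} (b : A' ⟶ A) (c : d.Φ.obj (op A)) (a : OrdInt (d.fld A))
    (hc : d.ιHom A c = Realification.of _ a) :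
    ∃ a' : OrdInt (d.fld A'), d.ιHom A' (Frobenioids.pull d.Φ b c) = Realification.of _ a' := by
  have hnat := congrArg (fun f => (CommMonCat.Hom.hom f) c) (d.ι.naturality b.op)
  refine ⟨ordIntMapOfHom (d.base.map b).alg (d.base.map b).isValHom a, ?_⟩
  change d.ιHom A' ((d.Φ.map b.op).hom c) = _
  rw [CommMonCat.comp_apply] at hnat
  change d.ιHom A' ((d.Φ.map b.op).hom c) = ((phiZeroOn d.base).map b.op).hom (d.ιHom A c) at hnat
  rw [hnat, hc]
  rfl

/-- **A self-equivalence over the identity of the base induces the identity on the divisor monoid** (`hdiv@C_v`):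
for the `p`-adic Frobenioid of `d` over a slim base of FSM-type with (INT) `ord(O^⊳) ⊗ 1 ⊆ Φ` and (PF) `Φ ⊆ (ord(O^⊳) ⊗ 1)^pf`,
every `Ψ : C ≌ C` with `η₀ : Ψ ⋙ Base ≅ Base` has `Div(Ψ φ) = η₀^* Div(φ)` for all `φ`.
[cite: MochizukiFrdI2008, Cor. 4.11 (iv) p.92] [cite: Mochizuki2012, Cor. 5.3(iv) p.145] -/
theorem div_map_eq_pull_of_over_base (hD : IsOfFSMType D) (hsl : IsSlim D)
    (hint : ∀ (A : D) (a : OrdInt (d.fld A)), ∃ c : d.Φ.obj (op A), d.ιHom A c = Realification.of _ a)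
    (hpf : ∀ (A : D) (c : d.Φ.obj (op A)), ∃ n : ℕ, 0 < n ∧ ∃ a : OrdInt (d.fld A),
      d.ιHom A (c ^ n) = Realification.of _ a)
    (Ψ : d.frobenioid ≌ d.frobenioid)
    (η₀ : Ψ.functor ⋙ ModelFrobenioid.baseFunctor d.Φ d.B d.divB ≅ ModelFrobenioid.baseFunctor d.Φ d.B d.divB)
    {X Y : d.frobenioid} (φ : X ⟶ Y) :
    ModelFrobenioid.div (Ψ.functor.map φ) =
      Frobenioids.pull d.Φ (η₀.hom.app X : (Ψ.functor.obj X).base ⟶ X.base) (ModelFrobenioid.div φ) := by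
  classical
  obtain ⟨ΨBase, Ecor, η, -, hdeg₀, hdiv, -⟩ := PadicFrd.exists_cor411iv_data_padic d d hD hD hsl hsl Ψ
  have hdeg : ∀ {V W : d.frobenioid} (χ : V ⟶ W),
      ModelFrobenioid.degFr (Ψ.functor.map χ) = ModelFrobenioid.degFr χ := fun χ => hdeg₀ χ
  -- notation: `T = η^* ∘ Ψ^Φ : Φ(A) → Φ(A')`, `S = η₀,* ∘ T : Φ(A) → Φ(A)` (`A = Base X`, `A' = Base ΨX`)
  let X' := Ψ.functor.obj X
  let e₀ : X'.base ⟶ X.base := η₀.hom.app X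
  let e₀' : X.base ⟶ X'.base := η₀.inv.app X
  have he₀ : e₀' ≫ e₀ = 𝟙 X.base := η₀.inv_hom_id_app X
  have he₀' : e₀ ≫ e₀' = 𝟙 X'.base := η₀.hom_inv_id_app X
  let T : d.Φ.obj (op X.base) →* d.Φ.obj (op X'.base) :=
    (Frobenioids.pull d.Φ (η.hom.app X)).comp (Ecor.iso X.base).toMonoidHom
  let S : d.Φ.obj (op X.base) →* d.Φ.obj (op X.base) := (Frobenioids.pull d.Φ e₀').comp T
  have hT : ∀ {Z : d.frobenioid} (χ : X ⟶ Z), ModelFrobenioid.div (Ψ.functor.map χ) = T (ModelFrobenioid.div χ) :=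
    fun χ => hdiv χ
  have hTinj : Injective T := by
    haveI : IsIso (d.Φ.map (η.hom.app X).op) := inferInstance
    exact (ModelFrobenioid.injective_hom_of_isIso_commMonCat (d.Φ.map (η.hom.app X).op)).comp (Ecor.iso X.base).injective
  have hpull_inj : Injective (Frobenioids.pull d.Φ e₀') := by
    intro x y hxy
    have h := congrArg (Frobenioids.pull d.Φ e₀) hxy
    rwa [← Frobenioids.pull_comp, ← Frobenioids.pull_comp, he₀', Frobenioids.pull_id, Frobenioids.pull_id] at h
  have hSinj : Injective S := hpull_inj.comp hTinj
  have hιA := d.ιHom_injective X.base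
  have hofA := Realification.of_injective (d.isMonoprime_ordInt_fld X.base)
  -- (1) `S` maps integral classes to integral classes
  have hSint : ∀ (c : d.Φ.obj (op X.base)) (a : OrdInt (d.fld X.base)), d.ιHom X.base c = Realification.of _ a →
      ∃ a' : OrdInt (d.fld X.base), d.ιHom X.base (S c) = Realification.of _ a' := by
    intro c a hc
    obtain ⟨χ, hχd, -, hχc⟩ := d.exists_linear_endo_of_ιHom_eq X c a hc
    obtain ⟨a₁, ha₁⟩ := d.exists_ιHom_div_eq_of_endo X' (Ψ.functor.map χ) (by rw [hdeg, hχd])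
    rw [hT, hχc] at ha₁
    exact d.exists_ιHom_pull_eq_of e₀' (T c) a₁ ha₁
  -- (2) … surjectively (fullness of `Ψ`)
  have hSsurj : ∀ a' : OrdInt (d.fld X.base), ∃ (c : d.Φ.obj (op X.base)) (a : OrdInt (d.fld X.base)),
      d.ιHom X.base c = Realification.of _ a ∧ d.ιHom X.base (S c) = Realification.of _ a' := by
    intro a'
    obtain ⟨c', hc'⟩ := hint X.base a'
    -- transport `c'` to `Φ(A')` along `e₀` : it stays integral; realise it as `Div` of a linear endomorphism of `X'`
    obtain ⟨a₁, ha₁⟩ := d.exists_ιHom_pull_eq_of e₀ c' a' hc'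
    obtain ⟨ψ, hψd, -, hψc⟩ := d.exists_linear_endo_of_ιHom_eq X' (Frobenioids.pull d.Φ e₀ c') a₁ ha₁
    let χ : X ⟶ X := Ψ.functor.preimage ψ
    have hχ : Ψ.functor.map χ = ψ := Ψ.functor.map_preimage ψ
    have hχd : ModelFrobenioid.degFr χ = 1 := by rw [← hdeg, hχ, hψd]
    obtain ⟨a, ha⟩ := d.exists_ιHom_div_eq_of_endo X χ hχd
    refine ⟨ModelFrobenioid.div χ, a, ha, ?_⟩
    have h1 : T (ModelFrobenioid.div χ) = Frobenioids.pull d.Φ e₀ c' := by rw [← hT, hχ, hψc]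
    change d.ιHom X.base (Frobenioids.pull d.Φ e₀' (T (ModelFrobenioid.div χ))) = _
    rw [h1, ← Frobenioids.pull_comp, he₀, Frobenioids.pull_id, hc']
  -- (3) the induced automorphism of `ord(O^⊳_{K_A}) ≅ ℤ_{≥0}` is the identity
  choose ca hca' using hint X.base
  have hga : ∀ a : OrdInt (d.fld X.base), ∃ a' : OrdInt (d.fld X.base),
      d.ιHom X.base (S (ca a)) = Realification.of _ a' := fun a => hSint (ca a) a (hca' a)
  choose g hg using hga
  have hca_one : ca 1 = 1 := hιA (by rw [hca', map_one, map_one])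
  have hca_mul : ∀ a b, ca (a * b) = ca a * ca b := fun a b =>
    hιA (by rw [hca', map_mul, map_mul, hca', hca'])
  let gHom : OrdInt (d.fld X.base) →* OrdInt (d.fld X.base) :=
    { toFun := g
      map_one' := hofA (by rw [← hg, hca_one, map_one, map_one, map_one])
      map_mul' := fun a b => hofA (by rw [← hg, hca_mul, map_mul, map_mul, map_mul, hg, hg]) }
  have hg_inj : Injective gHom := by
    intro a b hab
    have h1 : d.ιHom X.base (S (ca a)) = d.ιHom X.base (S (ca b)) := by
      change g a = g b at hab
      rw [hg, hg, hab]
    have h2 : ca a = ca b := hSinj (hιA h1)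
    exact hofA (by rw [← hca', ← hca', h2])
  have hg_surj : Surjective gHom := by
    intro a'
    obtain ⟨c, a, hc, hSc⟩ := hSsurj a'
    refine ⟨a, hofA ?_⟩
    have h1 : ca a = c := hιA (by rw [hca', hc])
    change Realification.of _ (g a) = _
    rw [← hg, h1, hSc]
  let τ : OrdInt (d.fld X.base) ≃* OrdInt (d.fld X.base) := MulEquiv.ofBijective gHom ⟨hg_inj, hg_surj⟩
  have hτ : τ = MulEquiv.refl _ := mulEquiv_eq_of_isZMonoprime (d.isZMonoprime_ordInt_fld X.base) τ _
  -- hence `S` fixes every integral class …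
  have hSintfix : ∀ (c : d.Φ.obj (op X.base)) (a : OrdInt (d.fld X.base)),
      d.ιHom X.base c = Realification.of _ a → S c = c := by
    intro c a hc
    have h1 : ca a = c := hιA (by rw [hca', hc])
    have h2 : g a = a := by
      have h := MulEquiv.congr_fun hτ a
      exact h
    apply hιA
    rw [← h1, hg, h2, hca']
  -- … and, by (PF) and uniqueness of roots, every class
  have hSfix : ∀ c : d.Φ.obj (op X.base), S c = c := by
    intro c
    obtain ⟨n, hn, a, ha⟩ := hpf X.base c
    have h1 : S (c ^ n) = c ^ n := hSintfix (c ^ n) a ha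
    have h2 : d.ιHom X.base (S c) ^ n = d.ιHom X.base c ^ n := by
      rw [← map_pow (d.ιHom X.base) (S c) n, ← map_pow (d.ιHom X.base) c n, ← map_pow S c n, h1]
    exact hιA (Realification.pow_left_injective hn h2)
  -- conclusion: `Div(Ψ φ) = T (Div φ) = e₀^* S (Div φ) = e₀^* Div φ`
  have hTS : ∀ c, T c = Frobenioids.pull d.Φ e₀ (S c) := by
    intro c
    change T c = Frobenioids.pull d.Φ e₀ (Frobenioids.pull d.Φ e₀' (T c))
    rw [← Frobenioids.pull_comp, he₀', Frobenioids.pull_id]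
  rw [hT, hTS, hSfix]
  rfl

end Datum

end PadicFrd

end Literature.AlgebraicGeometry.Frobenioids
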